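import Summits.BirchSwinnertonDyer.BirchSwinnertonDyer.Theorems.GenusKolyvaginAtTwoEquivariantKolyvaginExactAtTwoSelmerDescentUnramified
import Literature.NumberTheory.GaloisRepresentations.InertiaFixesSquareRootsProofs
import HarnessLib

/-!
# Route `GenusKolyvaginAtTwo`, LINE 6, KEY crux Q3 (inner statement of stmt-BirchSwinnertonDyer-22137):
# Lemma 4.3 descends from the quadratic field `K = ℚ(√c)` to `ℚ` at every ODD GOOD place `v ∤ c·n`

Helper (seat `bsd-line-gk2-p3` g12; `--supports` the crux, closes nothing). Sequel to
`…SelmerDescentUnramified` (`SelmerDescent.mem_selmerLocalKer_of_resTorsion_mem_of_inertia_le`: the Selmer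
local condition descends along `L/F` at a good place `v ∤ n` whose inertia group satisfies `I_𝔓 ≤ res(Γ_L)`).
This file DISCHARGES that Galois-form hypothesis for a quadratic field `K = ℚ(θ)`, `θ² = c ∈ ℤ`, at an odd
place `v ∤ c`: the inertia group `I_𝔓 ≤ Γ_ℚ` fixes `√c` (the tree's
`smul_eq_of_mem_inertia_of_sq_eq_of_notMem`, Neukirch II (7.13): `ℚ(√c)/ℚ` is unramified at `v ∤ 2c`), hence
fixes the copy `e(K) ⊂ ℚ̄` for which `res(Γ_K) = Gal(ℚ̄/e(K))` (`exists_mem_range_absGaloisRestrict_iff`),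
`K` being generated by `θ` (`[K : ℚ] = 2`, `θ ∉ ℚ`).

* `adjoin_simple_eq_top_of_finrank_eq_two` — in a degree-`2` extension every element outside the base
  field is primitive (bookkeeping).
* `inertia_le_range_absGaloisRestrict_of_sq_eq` — **`I_𝔓 ≤ res(Γ_K)` for `K = ℚ(√c)`, `𝔓 ∣ v`, `v ∤ 2c`.**
* `mem_selmerLocalKer_of_resTorsion_mem_quadratic` — **for `E/ℚ`, `n : ℤ`, an odd good place `v ∤ c·n` and
  `w ∣ v`: if `res_K x` is Selmer at `w` then `x` is Selmer at `v`** — McCallum's Lemma 4.3 transported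
  from the Heegner field `K` (where it is proved for Kolyvagin's classes) to `ℚ` (where the pair descent of
  LINE 6 runs), at every odd good place prime to `d_K` (split or inert alike). Not covered: `v ∣ d_K`
  (ramified; the DEF primes, memo Q3-RAT-LOCAL-v1 on the item), `v = 2`, bad places.

THEOREMS ONLY (no definition, no named fact, no `sorry`, standard axioms). BSD is not proved by any of this.

References: [McCallumLMS1991] §4 Lemma 4.3; [GrossLMS1991] Prop. 6.2 (1); [NeukirchANT1999] II (7.13),
I §9 (9.4)–(9.6); [SerreLocalFields1979] I §7 Prop. 22.
-/

set_option autoImplicit false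
set_option linter.dupNamespace false -- tree convention: `Summit.BirchSwinnertonDyer.BirchSwinnertonDyer.Theorems` (summit = sub-problem)

noncomputable section

open scoped Classical

namespace Summit.BirchSwinnertonDyer.BirchSwinnertonDyer.Theorems.GenusExact.SelmerDescent

open WeierstrassCurve NumberField IsDedekindDomain Field
open Literature.NumberTheory.EllipticCurves Literature.NumberTheory.GaloisRepresentations

/-! ## §1 Quadratic fields: inertia at `v ∤ 2c` lies in `res(Γ_{ℚ(√c)})` -/

section Quadratic

variable {K : Type} [Field K] [NumberField K]

/-- In an extension of degree `2` every element outside the base field is primitive: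
`Algebra.adjoin ℚ {θ} = ⊤`. [folklore] -/
theorem adjoin_simple_eq_top_of_finrank_eq_two (h2 : Module.finrank ℚ K = 2) {θ : K}
    (hθ : θ ∉ (algebraMap ℚ K).range) : Algebra.adjoin ℚ {θ} = ⊤ := by
  have hint : IsIntegral ℚ θ := .of_finite ℚ θ
  have hdeg : (minpoly ℚ θ).natDegree = Module.finrank ℚ K := by
    refine le_antisymm (minpoly.natDegree_le θ) ?_
    rw [h2]
    exact (minpoly.two_le_natDegree_iff hint).mpr hθ
  have htop : IntermediateField.adjoin ℚ {θ} = ⊤ :=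
    (Field.primitive_element_iff_minpoly_natDegree_eq ℚ θ).mpr hdeg
  rw [← IntermediateField.adjoin_simple_toSubalgebra_of_isAlgebraic hint.isAlgebraic, htop,
    IntermediateField.top_toSubalgebra]

/-- **The inertia group at an odd place `v ∤ c` lies in the image of `Γ_{ℚ(√c)} → Γ_ℚ`.** Let `K` be a
quadratic number field, `K = ℚ(θ)` with `θ² = c`, `c ∈ ℤ`, `θ ∉ ℚ`; let `v` be a finite place of `ℚ` with
`2 ∉ v`, `c ∉ v`, and `𝔓` a prime of `\bar ℤ` above `v`. Then `I_𝔓 ≤ res(Γ_K)`: by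
`exists_mem_range_absGaloisRestrict_iff` the image `res(Γ_K)` is the pointwise fixer of a copy `e(K) ⊂ ℚ̄`
(`e` a `ℚ`-algebra embedding); `σ ∈ I_𝔓` fixes `e(θ)` since `e(θ)² = c` is a `v`-unit and `v` is odd
(`smul_eq_of_mem_inertia_of_sq_eq_of_notMem`), and the elements of `K` fixed by `σ ∘ e` form a subalgebra
containing `θ`, i.e. all of `K = ℚ[θ]`. (`ℚ(√c)` is unramified outside `2c`.)
[cite: NeukirchANT1999, Ch. II Prop. (7.13) and Ch. I §9 Prop. (9.6)] -/
theorem inertia_le_range_absGaloisRestrict_of_sq_eq (h2 : Module.finrank ℚ K = 2) {θ : K}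
    (hθ : θ ∉ (algebraMap ℚ K).range) {c : ℤ} (hc : θ ^ 2 = algebraMap ℚ K c)
    (v : HeightOneSpectrum (𝓞 ℚ)) (h2v : (2 : 𝓞 ℚ) ∉ v.asIdeal) (hcv : ((c : ℤ) : 𝓞 ℚ) ∉ v.asIdeal)
    {𝔓 : Ideal (absIntegers (𝓞 ℚ) ℚ)} (h𝔓 : 𝔓 ∈ v.primesAbove) :
    𝔓.inertia (absoluteGaloisGroup ℚ) ≤ (absGaloisRestrict ℚ K).toMonoidHom.range := by
  haveI : Algebra.IsAlgebraic ℚ K := Algebra.IsAlgebraic.of_finite ℚ K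
  obtain ⟨e, he⟩ := exists_mem_range_absGaloisRestrict_iff ℚ K
  intro σ hσ
  rw [he]
  -- the subalgebra of elements of `K` whose image under `e` is fixed by `σ`
  let A : Subalgebra ℚ K :=
    { carrier := {x | σ • e x = e x}
      mul_mem' := fun {a b} ha hb => by
        change σ • e (a * b) = e (a * b)
        rw [map_mul, smul_mul', ha, hb]
      one_mem' := by
        change σ • e 1 = e 1
        rw [map_one, smul_one]
      add_mem' := fun {a b} ha hb => by
        change σ • e (a + b) = e (a + b)
        rw [map_add, smul_add, ha, hb]
      zero_mem' := by
        change σ • e 0 = e 0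
        rw [map_zero, smul_zero]
      algebraMap_mem' := fun q => by
        change σ • e (algebraMap ℚ K q) = e (algebraMap ℚ K q)
        rw [AlgHom.commutes, absoluteGaloisGroup.smul_def]
        exact AlgEquiv.commutes _ q }
  -- `θ ∈ A`: inertia fixes the square root `e θ` of the `v`-unit `c`
  have hα : (e θ) ^ 2 = algebraMap (𝓞 ℚ) (AlgebraicClosure ℚ) ((c : ℤ) : 𝓞 ℚ) := by
    rw [← map_pow, hc, AlgHom.commutes, IsScalarTower.algebraMap_apply (𝓞 ℚ) ℚ (AlgebraicClosure ℚ),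
      map_intCast, map_intCast, map_intCast]
  have hθA : θ ∈ A := smul_eq_of_mem_inertia_of_sq_eq_of_notMem v h𝔓 hσ h2v hcv hα
  -- hence `A = ⊤`
  have hA : A = ⊤ :=
    top_le_iff.mp ((adjoin_simple_eq_top_of_finrank_eq_two h2 hθ).symm.le.trans
      (Algebra.adjoin_le (Set.singleton_subset_iff.mpr hθA)))
  intro x
  have hx : x ∈ A := by rw [hA]; exact Algebra.mem_top
  exact hx

end Quadratic

/-! ## §2 Lemma 4.3 from `K = ℚ(√c)` down to `ℚ` at odd good places `v ∤ c n` -/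

section Descent

variable {K : Type} [Field K] [NumberField K] (W : WeierstrassCurve ℚ) [W.IsElliptic]

/-- **McCallum's Lemma 4.3 transported from the quadratic field to `ℚ` at an odd good place `v ∤ c·n`.**
Let `K = ℚ(θ)` be quadratic (`[K : ℚ] = 2`, `θ ∉ ℚ`, `θ² = c ∈ ℤ`), `E = W/ℚ` elliptic, `n : ℤ`, `v` a
place of good reduction with `v ∤ 2 c n`, and `w` a place of `K` above `v`. If the restriction
`res x ∈ H¹(K, E_K[n])` of `x ∈ H¹(ℚ, E[n])` satisfies the Selmer local condition of `E_K` at `w`, then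
`x` satisfies the Selmer local condition of `E` at `v`. (`I_𝔓 ≤ res(Γ_K)` by §1, then
`mem_selmerLocalKer_of_resTorsion_mem_of_inertia_le`.) For the pair descent of LINE 6: `c = d_K`, `n = 2^M`,
`v` any odd good prime `∤ d_K` — split or inert. [cite: McCallumLMS1991, §4 Lemma 4.3]
[cite: GrossLMS1991, Prop. 6.2 (1)] [cite: NeukirchANT1999, Ch. II Prop. (7.13)] -/
theorem mem_selmerLocalKer_of_resTorsion_mem_quadratic (h2 : Module.finrank ℚ K = 2) {θ : K}
    (hθ : θ ∉ (algebraMap ℚ K).range) {c : ℤ} (hc : θ ^ 2 = algebraMap ℚ K c) (n : ℤ)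
    (v : HeightOneSpectrum (𝓞 ℚ)) (w : HeightOneSpectrum (𝓞 K)) [w.asIdeal.LiesOver v.asIdeal]
    (hgood : W.HasGoodReductionAt v) (hn : (n : 𝓞 ℚ) ∉ v.asIdeal) (h2v : (2 : 𝓞 ℚ) ∉ v.asIdeal)
    (hcv : ((c : ℤ) : 𝓞 ℚ) ∉ v.asIdeal) {x : galH1Torsion W n}
    (hx : resTorsion W K n x ∈ selmerLocalKer (W.baseChange K) (w.adicCompletion K) n) :
    x ∈ selmerLocalKer W (v.adicCompletion ℚ) n := by
  haveI : Algebra.IsAlgebraic ℚ K := Algebra.IsAlgebraic.of_finite ℚ K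
  obtain ⟨𝔔, h𝔔⟩ := w.primesAbove_nonempty
  have hwv : w.asIdeal.under (𝓞 ℚ) = v.asIdeal :=
    (Ideal.LiesOver.over (P := w.asIdeal) (p := v.asIdeal)).symm
  have h𝔓 : 𝔔.comap (absIntegersMap ℚ K) ∈ v.primesAbove :=
    comap_absIntegersMap_mem_primesAbove hwv h𝔔
  exact mem_selmerLocalKer_of_resTorsion_mem_of_inertia_le W K v w n hgood hn h𝔔
    (inertia_le_range_absGaloisRestrict_of_sq_eq h2 hθ hc v h2v hcv h𝔓) hx

end Descent

end Summit.BirchSwinnertonDyer.BirchSwinnertonDyer.Theorems.GenusExact.SelmerDescent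

end
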